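import Summits.BirchSwinnertonDyer.BirchSwinnertonDyer.Theorems.KimAtThreeDeepLowerOffStratumLevelLoweringMultiStabDepleteRows
import Summits.BirchSwinnertonDyer.BirchSwinnertonDyer.Theorems.KimAtThreeDeepLowerOffStratumLevelLoweringDepleteIhara
import Literature.NumberTheory.EllipticCurves.LevelLoweringGamma0AtThreeAdditiveSign
import HarnessLib

/-!
# Route `KimAtThreeKolyvagin` (rung W2), crux `DeepLowerAtThreeOffKatoStratum` (item 19679), registered
# stub `stub_nonAdditive`, ROAD (b^k,add,A): the depth-`1` rows with (ram) whose Tamagawa `3` sits AT AN ADDITIVE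
# PLACE `ℓ` of Kodaira type `IV`/`IV*` — stabilise at `D`, deplete at the other dropping places `A`, DEPLETE AT `ℓ`

Cell `bsd-addord`, seat `bsd-addord-w2-acc2`, gen 8; item `stmt-BirchSwinnertonDyer-19679` (`--supports`, closes
nothing). ROAD (b^k,add,A) file 2 — the (A) rows of gen 7's census (17 647 optimal curves with `N < 5·10⁵`: the
Tamagawa `3` of a depth-`1` row sits at an additive place `ℓ` with `c_ℓ = 3`, all of them with `f_ℓ = 2`). There is
no multiplicative Tamagawa-`3` prime `q` to stabilise at; instead THEOREM A's slot `q` is `ℓ` itself. Compared with ★⁹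
(`…MultiStabDepleteRows.stub_nonAdditive_ram_of_exists_levelLoweredNewform_deplete`): the comparison form is the FULL
depletion `h = ι₁ G − a_ℓ(g) ι_ℓ G ∈ S₂(Γ₀(N))` of `G = (∏_{p∣A}(ι₁ − a_p ι_p))(∏_{p∣D}(ι₁ − β_p ι_p)) g`
(`…MultiDepleteData`, `…MultiStabData`), congruent to `f_E` in ALL coefficients; its OLD SHAPE is read one step
earlier, `plusSymbol h (x) = Φ_G(x) − (a_ℓ(g)/ℓ)·Φ_G(ℓx)`, with constant `a_ℓ(g)/ℓ ≡ 1 (mod 𝔭)` because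
`a_ℓ(g) ≡ ℓ` when `3 ∣ c_ℓ` — the NEW named fact `carayol1986_cuspCoeff_congr_at_additiveDrop_three`
(Darmon–Diamond–Taylor Thm. 3.1 (e) read on `Φ_ℓ(𝔽̄_ℓ)[3] = E[3]^{I_ℓ}`); Condition 1 of `h` is
`…DepleteConditionOne`; the period producer at any level is unchanged; the NON-DEGENERACY is THEOREM D‴
(`…DepleteIhara`, Diamond–Ribet's Ihara lemma at `ℓ ∥ N/ℓ` BY NAME — the `U_ℓ`-relation gives nothing when
`a_ℓ ≡ ℓ`); THEOREM A and the (ram) consumer are untouched (`q := ℓ ∣ N`). Extra row conditions: `3ℓ < N/ℓ`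
(Diamond–Ribet's `N_Σ > 3p`) and `a_ℓ(f_E) = 0`. Theorems only; nothing booked; BSD is not proved by any of this.

* §1 `valuation_div_natCast_sub_one_lt_one` — `a/ℓ ≡ 1` from `a ≡ ℓ`.
* §2 ★¹²ᵃ `isStabilisedLevelLoweringCongruenceIn_of_exists_levelLoweredNewform_depleteAt` — the (LL₁) CERTIFICATE at `ℓ`
  (THEOREM A's output) from FIVE named facts + the row data + the existence of the optimal-level newform; no BSD-side
  binder (`Finite Ш`, optimality, (ram), …) is used for it.
* §3 ★¹² `stub_nonAdditive_ram_of_exists_levelLoweredNewform_depleteAt` — the (ram) consumer applied to §2 (ELEVEN facts).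
  The covered consumer («(ram) only if `3` is multiplicative») is applied in `…DepleteTamagawaRowsCovered`.
[cite: DarmonDiamondTaylor1995, Thm. 3.1 (e)] [cite: DiamondRibet1997, §4.5 Lemma 4.6] [cite: Vatsal1999, §1 (1.6), Thm. (1.13)]
[cite: GreenbergVatsal2000, §3 (17)–(19)] [cite: ColemanEdixhoven1998, Thm. 2.1] [cite: Skinner2016PacificMC, Thm. C (§1)]
[cite: Mazur1978, Cor. 4.1] [cite: Kim2022StructureSelmer, Conj. 1.10 (PDF p. 8)] [cite: AtkinLehner1970, Thm. 3, Thm. 5]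
-/

set_option autoImplicit false
-- the Theorems namespace of a single-conjunct summit repeats the summit name by design (D-0017)
set_option linter.dupNamespace false

noncomputable section

open scoped MatrixGroups ModularForm Classical NNReal

open CongruenceSubgroup WeierstrassCurve Literature.NumberTheory.EllipticCurves
  Literature.NumberTheory.EllipticCurves.ModularForms

namespace Summit.BirchSwinnertonDyer.BirchSwinnertonDyer.Theorems.KimAtThreeDeepLowerOffStratumLevelLoweringDepleteTamagawaRows

open Summit.BirchSwinnertonDyer.Rank1Residual Summit.BirchSwinnertonDyer.Rank1Residual.LevelLowering
open Summit.BirchSwinnertonDyer.BirchSwinnertonDyer.Theorems.KimAtThreeDeepLowerSmallDefect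
open Summit.BirchSwinnertonDyer.BirchSwinnertonDyer.Theorems.KimAtThreeDeepLowerNonAdditiveRows
open Summit.BirchSwinnertonDyer.BirchSwinnertonDyer.Theorems.KimAtThreeShallowEqDeepOffStratumNonAdditiveRows
open Summit.BirchSwinnertonDyer.BirchSwinnertonDyer.Theorems.KimAtThreeDeepLowerOffStratumSockets
open Summit.BirchSwinnertonDyer.BirchSwinnertonDyer.Theorems.KimAtThreeDeepLowerOffStratumNonAdditiveRows
open Summit.BirchSwinnertonDyer.BirchSwinnertonDyer.Theorems.KimAtThreeDeepLowerOffStratumLevelLoweringBridge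
open Summit.BirchSwinnertonDyer.BirchSwinnertonDyer.Theorems.KimAtThreeDeepLowerOffStratumLevelLoweringRekey
open Summit.BirchSwinnertonDyer.BirchSwinnertonDyer.Theorems.KimAtThreeDeepLowerOffStratumLevelLoweringVatsal
open Summit.BirchSwinnertonDyer.BirchSwinnertonDyer.Theorems.KimAtThreeDeepLowerOffStratumLevelLoweringVatsalRows
open Summit.BirchSwinnertonDyer.BirchSwinnertonDyer.Theorems.KimAtThreeDeepLowerOffStratumLevelLoweringVatsalStab
open Summit.BirchSwinnertonDyer.BirchSwinnertonDyer.Theorems.KimAtThreeDeepLowerOffStratumLevelLoweringVatsalStabRows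
open Summit.BirchSwinnertonDyer.BirchSwinnertonDyer.Theorems.KimAtThreeDeepLowerOffStratumLevelLoweringConditionOne
open Summit.BirchSwinnertonDyer.BirchSwinnertonDyer.Theorems.KimAtThreeDeepLowerOffStratumLevelLoweringNonEisensteinPrime
open Summit.BirchSwinnertonDyer.BirchSwinnertonDyer.Theorems.KimAtThreeDeepLowerOffStratumLevelLoweringRibetRows
open Summit.BirchSwinnertonDyer.BirchSwinnertonDyer.Theorems.KimAtThreeDeepLowerOffStratumLevelLoweringStabEigenform
  renaming heckeT_stab_of_ne → heckeT_stab_of_ne_eig, heckeT_stab_self → heckeT_stab_self_eig,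
    isHeckeEigenform_stab → isHeckeEigenform_stab_eig, cuspCoeff_stab_prime → cuspCoeff_stab_prime_eig,
    cuspCoeff_mul_cuspCoeff → cuspCoeff_mul_cuspCoeff_eig, heckeEigenvalue_stab → heckeEigenvalue_stab_eig,
    valuation_cuspCoeff_stab_le_one → valuation_cuspCoeff_stab_le_one_eig,
    finiteDimensional_coeffField_stab → finiteDimensional_coeffField_stab_eig
open Summit.BirchSwinnertonDyer.BirchSwinnertonDyer.Theorems.KimAtThreeDeepLowerOffStratumLevelLoweringStabEigenform (smul_plusSymbol_of_heckeT)
open Summit.BirchSwinnertonDyer.BirchSwinnertonDyer.Theorems.KimAtThreeDeepLowerOffStratumLevelLoweringDoubleStabData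
open Summit.BirchSwinnertonDyer.BirchSwinnertonDyer.Theorems.KimAtThreeDeepLowerOffStratumLevelLoweringMultiStabConditionOne
open Summit.BirchSwinnertonDyer.BirchSwinnertonDyer.Theorems.KimAtThreeDeepLowerOffStratumLevelLoweringMultiStabPeriodAnyLevel
open Summit.BirchSwinnertonDyer.BirchSwinnertonDyer.Theorems.KimAtThreeDeepLowerOffStratumLevelLoweringMultiStabData
open Summit.BirchSwinnertonDyer.BirchSwinnertonDyer.Theorems.KimAtThreeDeepLowerOffStratumLevelLoweringMultiDepleteData
open Summit.BirchSwinnertonDyer.BirchSwinnertonDyer.Theorems.KimAtThreeDeepLowerOffStratumLevelLoweringDepleteConditionOne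
open Summit.BirchSwinnertonDyer.BirchSwinnertonDyer.Theorems.KimAtThreeDeepLowerOffStratumLevelLoweringMultiStabRowsRam
open Summit.BirchSwinnertonDyer.BirchSwinnertonDyer.Theorems.KimAtThreeDeepLowerOffStratumLevelLoweringDepleteIhara
open Literature.NumberTheory.EllipticCurves.Rank1Residual Literature.NumberTheory.EllipticCurves.Rank1Residual.Typed
  Literature.NumberTheory.EllipticCurves.Skinner2016 Literature.NumberTheory.Automorphic
open IsDedekindDomain Rat.HeightOneSpectrum

/-! ### §1 The stabilisation constant `c = a_ℓ(g)/ℓ ≡ 1` -/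

section Constant

/-- **`a/ℓ ≡ 1 (mod 𝔪)` when `a ≡ ℓ` and `ℓ ≠ 3` is prime** (`ℓ` is a `3`-adic unit: `a/ℓ − 1 = (a − ℓ)/ℓ`).
[folklore] -/
theorem valuation_div_natCast_sub_one_lt_one (ι : PadicAlgCl 3 ≃+* ℂ) {a : ℂ} {ℓ : ℕ} (hℓ : ℓ.Prime) (hℓ3 : ℓ ≠ 3)
    (ha : Valued.v (ι.symm (a - ℓ)) < 1) : Valued.v (ι.symm (a / ℓ - 1)) < 1 := by
  have hℓ0 : (ℓ : ℂ) ≠ 0 := by exact_mod_cast hℓ.ne_zero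
  have h3ℓ : ¬ (3 : ℤ) ∣ (ℓ : ℤ) := by
    intro h
    have h' : 3 ∣ ℓ := by exact_mod_cast h
    exact hℓ3 ((Nat.prime_dvd_prime_iff_eq Nat.prime_three hℓ).mp h').symm
  have hnorm : ‖(ℓ : PadicAlgCl 3)‖ = 1 := by
    have h := norm_intCast_eq_one_of_not_dvd h3ℓ
    simpa using h
  have key : ι.symm (a / ℓ - 1) = ι.symm (a - ℓ) / ℓ := by
    rw [map_sub, map_one, map_div₀, map_natCast, map_sub, map_natCast]
    have hℓ0' : (ℓ : PadicAlgCl 3) ≠ 0 := by exact_mod_cast hℓ.ne_zero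
    field_simp
  refine valuation_lt_one_iff.mpr ?_
  rw [key, norm_div, hnorm, div_one]
  exact valuation_lt_one_iff.mp ha

end Constant

/-! ### §2 ★¹²ᵃ The (LL₁) certificate at an additive Tamagawa-`3` place -/

section Certificate

/-- ★¹²ᵃ **THE (LL₁) CERTIFICATE AT AN ADDITIVE TAMAGAWA-`3` PLACE.** For a tower-surjective `W₀` off the additive
stratum at `3`, the datum `D₀` at `N = M₁·D·A·ℓ` with `3`-integral plus symbols, an additive place `v` over the prime
`ℓ` of Kodaira type `IV`/`IV*` with `3 ∣ c_ℓ`, `ℓ ∥ M₁`, `ℓ ∤ DA`, `3ℓ < M₁DA` (Diamond–Ribet's `N_Σ > 3p`),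
`a_ℓ(f_E) = 0`, `D` and `A` squarefree and coprime (`D` prime to `M₁`), the primes of `A` dividing `M₁` once with
`a_p(f_E) = 0`, signs `a_p(f_E) = ±1` on `D`, and the EXISTENCE of a newform `g ∈ S₂(Γ₀(M₁))` congruent to `D₀.f` off
`D·A·ℓ` with `a_p(g) ≡ a_p(f)(p + 1)` on `D`: the stabilised level-lowering congruence
`IsStabilisedLevelLoweringCongruenceIn W₀ 3 1 D₀.f ℓ π` holds for some `π : ℤ/3 → 𝓀`. Inside: `G₁` = the `k`-fold
stabilisation of `g` at `D` (`exists_multiStab`), `G` = the `k`-fold depletion at `A` (`exists_multiDeplete`), the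
comparison form is the `ℓ`-DEPLETION `h = ι₁ G − a_ℓ(g) ι_ℓ G ∈ S₂(Γ₀(N))` (congruent to `D₀.f` in ALL coefficients,
`a_ℓ(h) = 0 = a_ℓ(f_E)`), the OLD SHAPE is `Φ_G(x) − (a_ℓ(g)/ℓ)Φ_G(ℓx)` with constant `≡ 1` by
`carayol1986_cuspCoeff_congr_at_additiveDrop_three` (`a_ℓ(g) ≡ ℓ` as `3 ∣ c_ℓ`), Condition 1 by `…DepleteConditionOne`,
the period producer at any level, the NON-DEGENERACY by THEOREM D‴ (`…DepleteIhara`, Diamond–Ribet's Ihara lemma at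
`ℓ ∥ N/ℓ` BY NAME), and THEOREM A. FIVE named facts. [cite: DiamondRibet1997, §4.5 Lemma 4.6]
[cite: DarmonDiamondTaylor1995, Thm. 3.1 (e)] [cite: Vatsal1999, §1 (1.6), Thm. (1.13)] [cite: GreenbergVatsal2000, §3 (17)–(19)]
[cite: ColemanEdixhoven1998, Thm. 2.1] [cite: AtkinLehner1970, Thm. 3, Thm. 5] -/
theorem isStabilisedLevelLoweringCongruenceIn_of_exists_levelLoweredNewform_depleteAt
    (hDR : diamondRibet1997_iharaLemma_at_dividingPrime_three_additive)
    (hCa : carayol1986_cuspCoeff_congr_at_additiveDrop_three)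
    (hCE : colemanEdixhoven1998_heckePolynomial_simpleRoots)
    (hV : vatsal1999_plusSymbol_congruence) (hGV : greenbergVatsal2000_plusSymbol_congruence) :
    ∀ (W₀ : WeierstrassCurve ℚ) [W₀.IsElliptic] [W₀.IsGloballyMinimal],
      (∀ n : ℕ, W₀.HasSurjectiveModNGaloisRep (3 ^ n : ℕ)) →
      ∀ {N : ℕ} [NeZero N], N = W₀.conductorNorm ℤ →
      ∀ (D₀ : ModularParametrizationData W₀ N),
        (∀ r : ℚ, ratPlusSymbol D₀.f r ≠ 0 → 0 ≤ padicValRat 3 (ratPlusSymbol D₀.f r)) →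
        ¬ (haveI : Fact (Nat.Prime 3) := ⟨Nat.prime_three⟩; Addv W₀ 3) →
        ∀ {M₁ D A ℓ : ℕ} [NeZero M₁] [Fact ℓ.Prime] (v : HeightOneSpectrum ℤ), M₁ * D * A * ℓ = N →
        natGenerator v = ℓ → W₀.HasAdditiveReductionAt v → 3 ∣ (W₀.kodairaSymbolAt v).componentGroupOrder →
        3 ∣ (W₀.baseChange ℚ_[ℓ]).localTamagawaNumber ℤ_[ℓ] →
        ℓ ∣ M₁ → ¬ ℓ ^ 2 ∣ M₁ → ¬ ℓ ∣ D * A → 3 * ℓ < M₁ * D * A → cuspCoeff D₀.f ℓ = 0 →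
        Squarefree D → Nat.Coprime D M₁ → Squarefree A → Nat.Coprime A D →
        (∀ p : ℕ, p.Prime → p ∣ A → p ∣ M₁ ∧ ¬ p ^ 2 ∣ M₁ ∧ cuspCoeff D₀.f p = 0) →
        (∀ p : ℕ, p.Prime → p ∣ D → ∃ u : ℤ, u * u = 1 ∧ cuspCoeff D₀.f p = u) →
        (∀ ι : PadicAlgCl 3 ≃+* ℂ, ∃ g : CuspForm (Gamma0 M₁) 2, IsNewform0 g ∧
          (∀ p : ℕ, p.Prime → ¬ p ∣ D * A * ℓ → Valued.v (ι.symm (cuspCoeff D₀.f p - cuspCoeff g p)) < 1) ∧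
          (∀ p : ℕ, p.Prime → p ∣ D → Valued.v (ι.symm (cuspCoeff g p - cuspCoeff D₀.f p * (p + 1))) < 1)) →
        ∃ π : ZMod 3 →+* IsLocalRing.ResidueField (Valued.integer (PadicAlgCl 3)),
          IsStabilisedLevelLoweringCongruenceIn W₀ 3 1 D₀.f ℓ π := by
  intro W₀ _ _ htower N _ hN D₀ hint hnA M₁ D A ℓ _ _ v hMDℓ hvℓ hadd h3Φ h3c
    hℓM₁ hℓ2M₁ hℓDA h3ℓ hfℓ hDsq hDM₁ hAsq hAD hA hsign hex
  subst hMDℓ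
  have hq : ℓ.Prime := Fact.out
  haveI : NeZero ℓ := ⟨hq.ne_zero⟩
  haveI : NeZero D := ⟨Squarefree.ne_zero hDsq⟩
  haveI : NeZero A := ⟨Squarefree.ne_zero hAsq⟩
  have hirr : W₀.HasIrreducibleModPGaloisRep 3 :=
    hasIrreducibleModPGaloisRep_of_hasSurjectiveModNGaloisRep W₀ 3 (by simpa using htower 1)
  have hℓD : ¬ ℓ ∣ D := fun h ↦ hℓDA (h.mul_right A)
  have hℓA : ¬ ℓ ∣ A := fun h ↦ hℓDA (h.mul_left D)
  -- `ℓ² ∣ N`, hence `ℓ ≠ 3` (`9 ∤ N` off the additive stratum at `3`)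
  have hℓ2N : ℓ ^ 2 ∣ W₀.conductorNorm ℤ := by
    rw [← hN, pow_two]
    exact mul_dvd_mul (hℓM₁.mul_right D |>.mul_right A) dvd_rfl
  have h9 : ¬ 3 ^ 2 ∣ W₀.conductorNorm ℤ := not_sq_dvd_conductorNorm_of_not_addv W₀ hnA
  have hℓ3 : ℓ ≠ 3 := by rintro rfl; exact h9 hℓ2N
  -- `ℓ ∥ M₁ D A` and Diamond–Ribet's size condition
  have hℓL : ℓ ∣ M₁ * D * A := (hℓM₁.mul_right D).mul_right A
  have hℓ2L : ¬ ℓ ^ 2 ∣ M₁ * D * A := by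
    intro h
    have hcop : Nat.Coprime (ℓ ^ 2) (D * A) :=
      Nat.Coprime.pow_left 2 ((Nat.Prime.coprime_iff_not_dvd hq).mpr hℓDA)
    exact hℓ2M₁ (hcop.dvd_of_dvd_mul_right (by rw [mul_assoc] at h; exact h))
  set ι : PadicAlgCl 3 ≃+* ℂ := Classical.choice (PadicAlgCl.nonempty_ringEquiv_complex 3) with hι
  obtain ⟨g, hg, hcp, hrem⟩ := hex ι
  have hf := D₀.isNewformOf
  -- the `k`-fold stabilisation `G₁` of `g` at the primes of `D` (level `M₁ D`)
  obtain ⟨G₁, hG₁eig, hG₁norm, hG₁int, hG₁fd, hG₁C, hG₁g, hG₁f, hG₁span⟩ :=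
    exists_multiStab hg ι (fun p ↦ cuspCoeff D₀.f p) hCE D hDsq hDM₁
      (fun p hp hpD ↦ by
        obtain ⟨u, hu, hfu⟩ := hsign p hp hpD
        refine ⟨u, hu, hfu, ?_⟩
        have h := hrem p hp hpD
        rwa [hfu] at h)
      (M₁ * D) rfl
  -- the `k`-fold depletion `G` of `G₁` at the primes of `A` (level `M₁ D A`); `a_p(g) = ±1 ≠ 0` at `p ∥ M₁`
  have hAat : ∀ p : ℕ, p.Prime → p ∣ A → p ∣ M₁ ∧ cuspCoeff g p ≠ 0 := by
    intro p hp hpA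
    obtain ⟨hpM, hp2, -⟩ := hA p hp hpA
    refine ⟨hpM, fun h0 ↦ ?_⟩
    have h1 := hg.cuspCoeff_sq_eq_one_of_dvd_of_not_sq_dvd hp hpM hp2
    rw [h0] at h1
    norm_num at h1
  obtain ⟨G, hGeig, hGnorm, hGint, hGfd, hGC, hGg, hGf, hGz, hGspan⟩ :=
    exists_multiDeplete hg ι (fun p ↦ cuspCoeff D₀.f p) hG₁eig hG₁norm hG₁int hG₁fd hG₁C hG₁g hG₁f hG₁span A hAsq hAD hAat
      (M₁ * D * A) rfl
  have hGp : ∀ {p : ℕ}, p.Prime → ¬ p ∣ M₁ * D * A → cuspCoeff G p = cuspCoeff g p :=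
    fun {p} hp hpL ↦ hGg p hp fun h ↦ hpL (by rw [mul_assoc]; exact h.mul_left M₁)
  -- the `U_ℓ`-eigenvalue `a = a_ℓ(G) = a_ℓ(g) = ±1`, `a ≡ ℓ` (the SIGN FACT, `3 ∣ c_ℓ`)
  have hGℓ : cuspCoeff G ℓ = cuspCoeff g ℓ := hGg ℓ hq hℓDA
  have hne : cuspCoeff G ℓ ≠ 0 := by
    rw [hGℓ]
    intro h0
    have h1 := hg.cuspCoeff_sq_eq_one_of_dvd_of_not_sq_dvd hq hℓM₁ hℓ2M₁
    rw [h0] at h1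
    norm_num at h1
  set a : ℂ := cuspCoeff G ℓ with hadef
  have hLN : ∀ {p : ℕ}, ¬ p ∣ W₀.conductorNorm ℤ → ¬ p ∣ M₁ * D * A := fun hpN h' ↦ hpN (hN ▸ h'.mul_right ℓ)
  have hDAℓN : ∀ {p : ℕ}, ¬ p ∣ W₀.conductorNorm ℤ → ¬ p ∣ D * A * ℓ := fun hpN h' ↦
    hpN (hN ▸ h'.trans ⟨M₁, by ring⟩)
  have hb : ∀ p : ℕ, p.Prime → ¬ p ∣ W₀.conductorNorm ℤ * 3 →
      Valued.v (ι.symm (cuspCoeff g p - (W₀.frobeniusTrace p : ℂ))) < 1 := by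
    intro p hp hpN3
    haveI : Fact p.Prime := ⟨hp⟩
    have hpN : ¬ p ∣ W₀.conductorNorm ℤ := fun h' ↦ hpN3 (h'.mul_right 3)
    have hfp : cuspCoeff D₀.f p = (W₀.frobeniusTrace p : ℂ) := by
      rw [hf.2 p, LFunction_apply_prime_eq_frobeniusTrace W₀ p (hasGoodReductionAtPrime_of_not_dvd_conductorNorm W₀ hpN)]
    rw [← hfp, ← Valuation.map_neg, ← map_neg, neg_sub]
    exact hcp p hp (hDAℓN hpN)
  have haℓ : Valued.v (ι.symm (a - ℓ)) < 1 := by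
    rw [hGℓ]
    refine (hCa W₀ hirr v ℓ hvℓ hℓ3 hadd h3Φ hℓM₁ hℓ2M₁ g hg ι fun r hr hrS ↦ hb r hr fun h' ↦ hrS ?_).1 h3c
    rcases (Nat.Prime.dvd_mul hr).mp h' with h' | h'
    · exact (h'.mul_left M₁).mul_right 3
    · exact dvd_mul_of_dvd_right h' _
  have hc : Valued.v (ι.symm (a / ℓ - 1)) < 1 := valuation_div_natCast_sub_one_lt_one ι hq hℓ3 haℓ
  -- the comparison form: the `ℓ`-DEPLETION `h = ι₁ G − a ι_ℓ G` at level `M₁ D A ℓ = N`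
  have hq₁ : M₁ * D * A * 1 ∣ M₁ * D * A * ℓ := mul_dvd_mul_left _ (one_dvd ℓ)
  have hqq : M₁ * D * A * ℓ ∣ M₁ * D * A * ℓ := dvd_rfl
  set h := iota (M₁ * D * A) (M₁ * D * A * ℓ) 1 2 hq₁ G - a • iota (M₁ * D * A) (M₁ * D * A * ℓ) ℓ 2 hqq G with hhdef
  have heig : IsHeckeEigenform h := isHeckeEigenform_deplete hq₁ hqq hGeig hGnorm hq hℓL
  have hnorm : IsNormalized h := isNormalized_stab G a hq₁ hqq hGnorm hq
  have hhint : ∀ n, Valued.v (ι.symm (cuspCoeff h n)) ≤ 1 :=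
    valuation_cuspCoeff_stab_le_one_of_le hq₁ hqq ι hGint (hGint ℓ)
  have hhfd : FiniteDimensional ℚ (coeffField h) :=
    finiteDimensional_coeffField_stab_of_mem hq₁ hqq hGfd (coeff_mem_coeffField G ℓ)
  have hhC : HasSimpleHeckeGenEigenspace h :=
    hasSimpleHeckeGenEigenspace_deplete_of_hasSimpleHeckeGenEigenspace hg hq₁ hqq (R := D * A) (mul_assoc M₁ D A)
      hGeig hGnorm hGC (fun p hp hpL ↦ hGg p hp fun h' ↦ hpL (by rw [mul_assoc]; exact h'.mul_left M₁)) hq hℓM₁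
      hℓDA hGℓ hne
  have hfC : HasSimpleHeckeGenEigenspace D₀.f := hasSimpleHeckeGenEigenspace_of_isNewform0 hf.1
  have hhp : ∀ {p : ℕ}, p.Prime → cuspCoeff h p = if p = ℓ then a - a else cuspCoeff G p :=
    fun hp ↦ cuspCoeff_stab_prime_eig hGnorm a hq₁ hqq hq hp
  -- congruence of ALL coefficients, from the primes
  have hcong : ∀ n : ℕ, Valued.v (ι.symm (cuspCoeff D₀.f n - cuspCoeff h n)) < 1 := by
    refine valuation_cuspCoeff_sub_lt_one_of_prime ι hf.1.2.1 heig hf.1.2.2 hnorm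
      (valuation_cuspCoeff_le_one_of_isNewformOf W₀ hf ι) hhint fun p hp ↦ ?_
    rw [hhp hp]
    by_cases hpq : p = ℓ
    · subst hpq
      rw [if_pos rfl, hfℓ, sub_self, sub_self, map_zero, Valuation.map_zero]
      exact zero_lt_one
    · rw [if_neg hpq]
      by_cases hpD : p ∣ D
      · exact hGf p hp hpD
      · by_cases hpA : p ∣ A
        · rw [(hA p hp hpA).2.2, hGz p hp hpA, sub_self, map_zero, Valuation.map_zero]
          exact zero_lt_one
        · have hpDAℓ : ¬ p ∣ D * A * ℓ := fun h' ↦ by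
            rcases (Nat.Prime.dvd_mul hp).mp h' with h' | h'
            · rcases (Nat.Prime.dvd_mul hp).mp h' with h' | h'
              · exact hpD h'
              · exact hpA h'
            · exact hpq ((Nat.prime_dvd_prime_iff_eq hp hq).mp h')
          have hpDA : ¬ p ∣ D * A := fun h' ↦ by
            rcases (Nat.Prime.dvd_mul hp).mp h' with h' | h'
            · exact hpD h'
            · exact hpA h'
          rw [hGg p hp hpDA]; exact hcp p hp hpDAℓ
  -- the OLD SHAPE data `(Φ, c, b) = (plusSymbol G, a/ℓ, a_·(g))`
  have hshape : ∀ x : ℚ, plusSymbol h x = plusSymbol G x - a / ℓ * plusSymbol G (ℓ * x) :=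
    fun x ↦ plusSymbol_stab G a hq₁ hqq x
  have hΦper : ∀ x : ℚ, plusSymbol G (x + 1) = plusSymbol G x := by
    intro x
    have e₁ := modularSymbol_add_intCast_holds G x 1
    have e₂ := modularSymbol_add_intCast_holds G (-x) (-1)
    simp only [plusSymbol]
    rw [show -(x + 1) = -x + ((-1 : ℤ) : ℚ) by push_cast; ring, e₂, show x + 1 = x + ((1 : ℤ) : ℚ) by push_cast; ring, e₁]
  have hTG : ∀ (p : ℕ) (hp : p.Prime), ¬ p ∣ M₁ * D * A →
      (haveI : NeZero p := ⟨hp.ne_zero⟩; heckeT (Gamma0 (M₁ * D * A)) 2 p G) = cuspCoeff g p • G := by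
    intro p hp hpL
    haveI : NeZero p := ⟨hp.ne_zero⟩
    rw [heckeT_eq_heckeEigenvalue_smul G p (hGeig p hp), heckeEigenvalue_eq_coeff_of_isNormalized hGnorm hp (hGeig p hp),
      ← hGp hp hpL]
    rfl
  have hΦhecke : ∀ p : ℕ, p.Prime → ¬ p ∣ W₀.conductorNorm ℤ * 3 → ∀ x : ℚ,
      cuspCoeff g p * plusSymbol G x = (∑ j : Fin p, plusSymbol G ((x + j) / p)) + plusSymbol G (p * x) := by
    intro p hp hpN3 x
    haveI : NeZero p := ⟨hp.ne_zero⟩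
    have hpL : ¬ p ∣ M₁ * D * A := hLN fun h' ↦ hpN3 (h'.mul_right 3)
    exact smul_plusSymbol_of_heckeT p hp hpL (hTG p hp hpL) x
  -- the numeral `r₀ ≡ 1 (mod N)` by Chebotarev, and the unit `a_{r₀}(g) − r₀ − 1`
  have hsurj : W₀.HasSurjectiveModNGaloisRep ((3 : ℕ) : ℤ) := by simpa only [pow_one] using htower 1
  obtain ⟨r₀, hr₀, -, hr₀S, -, hr₀1, hE₀⟩ := exists_prime_one_mod_not_dvd_frobeniusTrace_sub W₀ hsurj (M₁ * D * A * ℓ)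
  haveI : Fact r₀.Prime := ⟨hr₀⟩
  have hr₀L : ¬ r₀ ∣ M₁ * D * A := fun h' ↦ hr₀S (h'.mul_right ℓ)
  have hr₀1L : r₀ ≡ 1 [MOD M₁ * D * A] := hr₀1.of_mul_right ℓ
  have hr₀N : ¬ r₀ ∣ W₀.conductorNorm ℤ := by rwa [← hN]
  have hfr₀ : cuspCoeff D₀.f r₀ = (W₀.frobeniusTrace r₀ : ℂ) := by
    rw [hf.2 r₀, LFunction_apply_prime_eq_frobeniusTrace W₀ r₀ (hasGoodReductionAtPrime_of_not_dvd_conductorNorm W₀ hr₀N)]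
  have hunit : Valued.v (ι.symm (cuspCoeff g r₀ - (r₀ + 1))) = 1 := by
    refine valuation_cuspCoeff_sub_eq_one_of_congr ι hE₀ ?_
    rw [← hfr₀]; exact hcp r₀ hr₀ (hDAℓN hr₀N)
  -- the real structure of `G`: `G = Σ cᵢ φᵢ`, `φᵢ` real with `T_r φᵢ = a_r(g) φᵢ` (`r ∤ M₁DA`)
  obtain ⟨n, c, φ, hGsum⟩ := Submodule.mem_span_set'.mp hGspan
  have hreal : ∀ i m, (cuspCoeff (φ i : CuspForm (Gamma0 (M₁ * D * A)) 2) m).im = 0 := fun i ↦ (φ i).2.1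
  have hφT : ∀ (i : Fin n) (r : ℕ) (hr : r.Prime), ¬ r ∣ M₁ * D * A * ℓ →
      (haveI : NeZero r := ⟨hr.ne_zero⟩; heckeT (Gamma0 (M₁ * D * A)) 2 r (φ i : CuspForm (Gamma0 (M₁ * D * A)) 2)) =
        cuspCoeff g r • (φ i : CuspForm (Gamma0 (M₁ * D * A)) 2) :=
    fun i r hr hrS ↦ (φ i).2.2 r hr fun h' ↦ hrS (h'.mul_right ℓ)
  have he : ∀ r : ℕ, r.Prime → ¬ r ∣ M₁ * D * A * ℓ → IsIntegral ℤ (cuspCoeff g r) ∧ (cuspCoeff g r).im = 0 :=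
    fun r _ _ ↦ ⟨IsNewform0.isIntegral_coeff_holds hg r, hg.cuspCoeff_im_eq_zero r⟩
  have hbel : ∀ r : ℕ, r.Prime → ¬ r ∣ M₁ * D * A * ℓ → ¬ r ∣ W₀.conductorNorm ℤ * 3 →
      Valued.v (ι.symm (cuspCoeff g r - (W₀.frobeniusTrace r : ℂ))) < 1 := fun r hr _ hrN ↦ hb r hr hrN
  -- the period producer at ANY level, then THEOREM D‴ (Ihara at `ℓ ∥ M₁DA`)
  have hΩ : (∃ x : ℚ, plusSymbol h x ≠ 0) →
      ∃ Ω : ℂ, (∀ x : ℚ, Valued.v (ι.symm (plusSymbol G x / Ω)) ≤ 1) ∧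
        ∃ x₀ : ℚ, Valued.v (ι.symm ((plusSymbol G x₀ - a / ℓ * plusSymbol G (ℓ * x₀)) / Ω)) = 1 := by
    rintro ⟨x, hx⟩
    have hne0 : ∃ y : ℚ, plusSymbol (∑ i, c i • (φ i : CuspForm (Gamma0 (M₁ * D * A)) 2)) y ≠ 0 := by
      by_contra hall
      push Not at hall
      rw [hGsum] at hall
      exact hx (by rw [hshape, hall, hall, mul_zero, sub_zero])
    have hTsum := hTG r₀ hr₀ hr₀L
    rw [← hGsum] at hTsum
    obtain ⟨Ω, hΩint, γ₀, hγ₀, hΩu⟩ := exists_period_integral_unit_cycle_sum_smul_of_one_mod (c := c) ι hreal hne0 hr₀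
      hr₀L hr₀1L (valuation_cuspCoeff_le_one_of_isNewform0 hg ι r₀) hTsum hunit
    obtain ⟨x₀, hx₀⟩ := exists_valuation_stabilisedSymbol_eq_one_sum_smul_of_diamondRibet hDR W₀ hirr hq hℓL hℓ2L h3ℓ
      hℓ3 hℓ2N hφT he hreal c ι hbel hΩint γ₀ hγ₀ hΩu hr₀ hr₀S hr₀1 hunit hc
    rw [hGsum] at hΩint hx₀
    exact ⟨Ω, hΩint, x₀, hx₀⟩
  -- THEOREM A (with producer)
  exact isStabilisedLevelLoweringCongruenceIn_three_of_not_addv_of_exists_period hV hGV W₀ htower hN D₀ hint hnA ι h ℓ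
    hfC heig hnorm hhfd hhint hhC hcong (plusSymbol G) (a / ℓ) (fun p ↦ cuspCoeff g p) hshape hc hΦper hb hΦhecke hΩ

end Certificate

/-! ### §3 ★¹² The (A) rows: the (ram) consumer and the covered consumer -/

section Rows

/-- ★¹² **`stub_nonAdditive` (crux 19679) on its depth-`1` rows WITH (ram) whose Tamagawa `3` sits AT AN ADDITIVE PLACE
`ℓ` of Kodaira type `IV`/`IV*` (`3 ∣ c_ℓ`), at ANY conductor — from ELEVEN NAMED FACTS + the row conditions of ★¹²ᵃ +
the EXISTENCE of the optimal-level newform**: stub binders VERBATIM + «ordinary if good at `3`» + `Ram W₀ 3` +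
`v₃(∏ c_ℓ) ≤ 1`, then ★¹²ᵃ's data; the certificate of ★¹²ᵃ is fed to the (ram) consumer
`…MultiStabRowsRam.stub_nonAdditive_ram_of_isStabilisedLevelLoweringCongruenceIn` at `q := ℓ ∣ N`.
[cite: DiamondRibet1997, §4.5 Lemma 4.6] [cite: DarmonDiamondTaylor1995, Thm. 3.1 (e)] [cite: Skinner2016PacificMC, Thm. C (§1)]
[cite: Mazur1978, Cor. 4.1] [cite: Kim2022StructureSelmer, Conj. 1.10 (PDF p. 8)] [cite: Vatsal1999, §1 (1.6), Thm. (1.13)] -/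
theorem stub_nonAdditive_ram_of_exists_levelLoweredNewform_depleteAt
    (hDR : diamondRibet1997_iharaLemma_at_dividingPrime_three_additive)
    (hCa : carayol1986_cuspCoeff_congr_at_additiveDrop_three)
    (hCE : colemanEdixhoven1998_heckePolynomial_simpleRoots)
    (hV : vatsal1999_plusSymbol_congruence) (hGV : greenbergVatsal2000_plusSymbol_congruence)
    (hSk : Skinner2016.thmC_padicValRat_bsd_rank_zero)
    (hmod : hasEntireLFunction_rat) (hGZK : rank_eq_analyticRank_of_analyticRank_le_one)
    (hM : mazur_not_dvd_maninConstant_of_odd) :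
    ∀ (W₀ : WeierstrassCurve ℚ) [W₀.IsElliptic] [W₀.IsGloballyMinimal],
      (∀ n : ℕ, W₀.HasSurjectiveModNGaloisRep (3 ^ n : ℕ)) → Finite W₀.sha →
      ∀ {N : ℕ} [NeZero N], N = W₀.conductorNorm ℤ →
      ∀ (D₀ : ModularParametrizationData W₀ N),
        (∀ z ∈ D₀.L.lattice, ∃ w ∈ periodLattice D₀.f, z = D₀.c * w) →
        (∀ (W₂ : WeierstrassCurve ℚ) [W₂.IsElliptic] (D₂ : ModularParametrizationData W₂ N),
          D₂.f = D₀.f → D₀.modularDegree ≤ D₂.modularDegree) →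
        (∀ r : ℚ, ratPlusSymbol D₀.f r ≠ 0 → 0 ≤ padicValRat 3 (ratPlusSymbol D₀.f r)) →
        kuriharaVanishingOrder W₀ 3 D₀.f = 0 →
        ¬ (haveI : Fact (Nat.Prime 3) := ⟨Nat.prime_three⟩; Addv W₀ 3) →
        (W₀.HasGoodReductionAtPrime 3 → ¬ (3 : ℤ) ∣ W₀.frobeniusTrace 3) →
        (haveI : Fact (Nat.Prime 3) := ⟨Nat.prime_three⟩; Ram W₀ 3) →
        padicValNat 3 W₀.tamagawaProduct ≤ 1 →
        ∀ {M₁ D A ℓ : ℕ} [NeZero M₁] [Fact ℓ.Prime] (v : HeightOneSpectrum ℤ), M₁ * D * A * ℓ = N →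
        natGenerator v = ℓ → W₀.HasAdditiveReductionAt v → 3 ∣ (W₀.kodairaSymbolAt v).componentGroupOrder →
        3 ∣ (W₀.baseChange ℚ_[ℓ]).localTamagawaNumber ℤ_[ℓ] →
        ℓ ∣ M₁ → ¬ ℓ ^ 2 ∣ M₁ → ¬ ℓ ∣ D * A → 3 * ℓ < M₁ * D * A → cuspCoeff D₀.f ℓ = 0 →
        Squarefree D → Nat.Coprime D M₁ → Squarefree A → Nat.Coprime A D →
        (∀ p : ℕ, p.Prime → p ∣ A → p ∣ M₁ ∧ ¬ p ^ 2 ∣ M₁ ∧ cuspCoeff D₀.f p = 0) →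
        (∀ p : ℕ, p.Prime → p ∣ D → ∃ u : ℤ, u * u = 1 ∧ cuspCoeff D₀.f p = u) →
        (∀ ι : PadicAlgCl 3 ≃+* ℂ, ∃ g : CuspForm (Gamma0 M₁) 2, IsNewform0 g ∧
          (∀ p : ℕ, p.Prime → ¬ p ∣ D * A * ℓ → Valued.v (ι.symm (cuspCoeff D₀.f p - cuspCoeff g p)) < 1) ∧
          (∀ p : ℕ, p.Prime → p ∣ D → Valued.v (ι.symm (cuspCoeff g p - cuspCoeff D₀.f p * (p + 1))) < 1)) →
        ∃ d : ℕ, kuriharaPartialDeepInfty W₀ 3 D₀.f = d ∧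
          kuriharaPartial W₀ 3 D₀.f 0 ≤
            ((padicValNat 3 (Nat.card (AddCommGroup.primaryComponent W₀.sha 3)) + d : ℕ) : ℕ∞) := by
  intro W₀ _ _ htower hfin N _ hN D₀ hopt hdeg hint hord hnA hordinary hram hv M₁ D A ℓ _ _ v hMDℓ hvℓ hadd h3Φ h3c
    hℓM₁ hℓ2M₁ hℓDA h3ℓ hfℓ hDsq hDM₁ hAsq hAD hA hsign hex
  obtain ⟨π, hLL⟩ := isStabilisedLevelLoweringCongruenceIn_of_exists_levelLoweredNewform_depleteAt hDR hCa hCE hV hGV W₀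
    htower hN D₀ hint hnA v hMDℓ hvℓ hadd h3Φ h3c hℓM₁ hℓ2M₁ hℓDA h3ℓ hfℓ hDsq hDM₁ hAsq hAD hA hsign hex
  exact stub_nonAdditive_ram_of_isStabilisedLevelLoweringCongruenceIn hSk hmod hGZK hM W₀ htower hfin hN D₀ hopt hdeg
    hint hord hnA hordinary hram hv π ℓ (by rw [← hN, ← hMDℓ]; exact dvd_mul_left ℓ _) hLL

end Rows

end Summit.BirchSwinnertonDyer.BirchSwinnertonDyer.Theorems.KimAtThreeDeepLowerOffStratumLevelLoweringDepleteTamagawaRows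

end
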